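import Summits.MatrixMultiplication.MatrixMultiplication.Theses.KroneckerRatioLaw
import Literature.Computability.AlgebraicComplexity.TensorRestrictionRank
import Literature.Computability.AlgebraicComplexity.SmallFormatMatMulRankTwoHolds
import Literature.Computability.AlgebraicComplexity.RectangularExponent
import Literature.Computability.AlgebraicComplexity.MatMulRankLowerBoundsBlaserProofs

/-!
# Strategist r1 — anatomy of the deciding crux `MonotoneTower` (stmt-MatrixMultiplication-17643)
# of route `KroneckerRatioLaw` (redirect scan 2026-08-17, flag `smuggling; attack=1`)

Everything here is PROVED (no `sorry`); `advxxz2025_omega_le` (`ω ≤ 2.371339`, the vendored record)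
enters one corollary as a NAMED-FACT hypothesis.  Write `g(n) := R(⟨n,n,n⟩)` (tensor rank over `ℂ`) and,
for a real `β` and a Kronecker tower `N, Nm, Nm², …`,

  `TowerLaw β N m : ∀ k, m^β · g(N m^k) ≤ g(N m^(k+1))`.

The crux is `MonotoneTower = ∃ N ≥ 1, m ≥ 2, TowerLaw ω N m` (`monotoneTower_iff`, by `Iff.rfl`).

## What the theorems below establish

1. `towerLaw_exponent_le_omega` : `TowerLaw β N m → β ≤ ω` for EVERY tower.  Hence
   `monotoneTower_iff_isGreatest` : the crux says **ω is ATTAINED as the greatest uniform step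
   exponent of some tower** — the two-level analogue of "ω is a minimum", where Coppersmith–Winograd
   1982 prove the one-level version false (`InfimumNotMinimumBarrier`).  The constant `m^ω` sits on a
   knife edge: `towerLaw_gt_two_refutes` — any `β > 2` in place of `ω` REFUTES the summit
   (`towerLaw_record_pins_omega`: with the record constant `m^2.371339` it pins `ω = 2.371339`);
   `monotoneTower_imp_shadow` / `summit_imp_shadow_iff` — with `m²` in place of `m^ω` one gets the
   ω-free shadow `TowerLaw 2`, implied by the crux, equivalent to it under `ω = 2`, and useless to the
   route's `closes` (it carries no information on `ω`).  So no certified quantity can stand in for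
   `m^ω`: the crux is load-bearing ONLY through the literal appearance of `ω`.
2. `summit_imp_efficientSteps` : `ω = 2 → EfficientSteps` (the route's second binder is a CONSEQUENCE
   of the summit), whence `residual_iff_summit` : `MonotoneTower → (EfficientSteps ↔ ω = 2)`.
   Given the crux, the route's remaining obligation IS the summit: `closes` reduces `S` to `S`.
   (The only registered line for `EfficientSteps`, `stub_towerSelfReduction`, was shown summit-strength
   by refuter-rattack-17707, evidence StubRestatesSummit.lean.)
3. `towerLaw_prices` : each instance `k` of the crux is the ω-upper bound `ω ≤ log_m (g_{k+1}/g_k)`;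
   `doubling_step_one` : on the doubling tower the first non-trivial instance reads
   `7·2^ω ≤ R(⟨4,4,4⟩)` (`R(⟨2,2,2⟩) = 7`, tree), and `doubling_step_one_price` : certifying it with any
   outcome `R(⟨4,4,4⟩) ≤ 36` would give `ω < 2.37`, below the 2.371339 record — i.e. the cheapest
   instance of the crux already requires either a new exponent record or the rank lower bound
   `R(⟨4,4,4⟩) ≥ 37` (known: 29 ≤ R(⟨4,4,4⟩) ≤ 48).  No instance beyond the `N = 1, k = 0` face
   (Bläser Thm 5.9) is decidable today.

Conclusion for the tribunal (STRATEGY-CENSUS.md): the crux is not the summit restated (C→S and S→C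
probes fail; it is logically INCOMPARABLE with `ω = 2`), but the ROUTE is the summit in costume —
`closes = MonotoneTower → (EfficientSteps ↔ S)` with `S → EfficientSteps` — and the crux itself is an
exact-rank law with attack surface zero.
-/

noncomputable section

set_option linter.dupNamespace false

namespace Summit.MatrixMultiplication.MatrixMultiplication.Cruxes.MonotoneTower.StrategistR1

open Literature.Computability.AlgebraicComplexity
open Summit.MatrixMultiplication.MatrixMultiplication.Theses.KroneckerRatioLaw

/-- `g(n) = R(⟨n,n,n⟩)` over `ℂ`, as a real number (notation only). -/
local notation "g(" n ")" => ((tensorRank (matMulTensor ℂ n n n) : ℕ) : ℝ)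

/-- The step law with exponent `β` along the Kronecker tower `N, Nm, Nm², …`:
`m^β · g(N m^k) ≤ g(N m^(k+1))` for every `k`. [folklore] -/
def TowerLaw (β : ℝ) (N m : ℕ) : Prop :=
  ∀ k : ℕ, (m : ℝ) ^ β * g(N * m ^ k) ≤ g(N * m ^ (k + 1))

/-- The crux, verbatim, is the `β = ω` tower law on some tower. [folklore] -/
theorem monotoneTower_iff :
    MonotoneTower ↔ ∃ N m : ℕ, 1 ≤ N ∧ 2 ≤ m ∧ TowerLaw (omega ℂ) N m := Iff.rfl

/-- `g(N m^k) ≥ 1` once `N ≥ 1`, `m ≥ 1` (flattening bound `n² ≤ R(⟨n,n,n⟩)`). [folklore] -/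
theorem one_le_g {N m : ℕ} (hN : 1 ≤ N) (hm : 1 ≤ m) (k : ℕ) : (1 : ℝ) ≤ g(N * m ^ k) := by
  have h1 := matMulTensor_sq_le_tensorRank ℂ (N * m ^ k)
  have hNk : 1 ≤ N * m ^ k :=
    Nat.one_le_iff_ne_zero.2 (Nat.mul_ne_zero (by omega) (pow_ne_zero _ (by omega)))
  have h2 : 1 ≤ (N * m ^ k) ^ 2 := Nat.one_le_pow _ _ hNk
  exact_mod_cast h2.trans h1

/-- Unrolling a tower law: `(m^β)^k · g(N) ≤ g(N m^k)`. [folklore] -/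
theorem towerLaw_unroll {β : ℝ} {N m : ℕ} (h : TowerLaw β N m) :
    ∀ k : ℕ, ((m : ℝ) ^ β) ^ k * g(N * m ^ 0) ≤ g(N * m ^ k) := by
  intro k
  induction k with
  | zero => simp
  | succ k ih =>
    have hmβ : (0 : ℝ) ≤ (m : ℝ) ^ β := Real.rpow_nonneg (Nat.cast_nonneg _) _
    calc ((m : ℝ) ^ β) ^ (k + 1) * g(N * m ^ 0)
        = (m : ℝ) ^ β * (((m : ℝ) ^ β) ^ k * g(N * m ^ 0)) := by ring
      _ ≤ (m : ℝ) ^ β * g(N * m ^ k) := mul_le_mul_of_nonneg_left ih hmβ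
      _ ≤ g(N * m ^ (k + 1)) := h k

/-- **Every tower law exponent is at most `ω`.**  If `m^β g(N m^k) ≤ g(N m^(k+1))` for all `k`
(`N ≥ 1`, `m ≥ 2`) then `β ≤ ω`: otherwise `g(N m^k) ≥ m^{βk}` outgrows `C·(N m^k)^{ω+δ}` for
`δ = (β-ω)/2`. So the crux asserts that `ω` is ATTAINED as a uniform step exponent. [folklore] -/
theorem towerLaw_exponent_le_omega {β : ℝ} {N m : ℕ} (hN : 1 ≤ N) (hm : 2 ≤ m)
    (h : TowerLaw β N m) : β ≤ omega ℂ := by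
  by_contra hlt
  push_neg at hlt
  set δ : ℝ := (β - omega ℂ) / 2 with hδ
  have hδ0 : 0 < δ := by rw [hδ]; linarith
  obtain ⟨C, hC, hb⟩ := exists_tensorRank_matMulTensor_le_rpow ℂ hδ0
  have hm1 : (1 : ℝ) < m := by exact_mod_cast hm
  have hm0 : (0 : ℝ) < m := by linarith
  have hlm : 0 < Real.log m := Real.log_pos hm1
  have hN0 : (0 : ℝ) < N := by exact_mod_cast hN
  have hg0 : (1 : ℝ) ≤ g(N * m ^ 0) := one_le_g hN (by omega) 0
  have key : ∀ k : ℕ, (k : ℝ) * (δ * Real.log m) ≤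
      Real.log C + (omega ℂ + δ) * Real.log N := by
    intro k
    have hlow := towerLaw_unroll h k
    have hmβ : (0 : ℝ) < (m : ℝ) ^ β := Real.rpow_pos_of_pos hm0 _
    have hpow : (0 : ℝ) < ((m : ℝ) ^ β) ^ k := pow_pos hmβ _
    have h1 : ((m : ℝ) ^ β) ^ k ≤ g(N * m ^ k) := by
      have := mul_le_mul_of_nonneg_left hg0 hpow.le
      rw [mul_one] at this
      exact this.trans hlow
    have hNk : 1 ≤ N * m ^ k :=
      Nat.one_le_iff_ne_zero.2 (Nat.mul_ne_zero (by omega) (pow_ne_zero _ (by omega)))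
    have h2 := hb (N * m ^ k) hNk
    have hNk0 : (0 : ℝ) < ((N * m ^ k : ℕ) : ℝ) := by exact_mod_cast hNk
    have h3 : ((m : ℝ) ^ β) ^ k ≤ C * ((N * m ^ k : ℕ) : ℝ) ^ (omega ℂ + δ) := h1.trans h2
    have h4 := Real.log_le_log hpow h3
    rw [Real.log_pow, Real.log_rpow hm0,
      Real.log_mul hC.ne' (Real.rpow_pos_of_pos hNk0 _).ne', Real.log_rpow hNk0] at h4
    push_cast at h4
    rw [Real.log_mul hN0.ne' (pow_pos hm0 _).ne', Real.log_pow] at h4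
    have hβ : β = omega ℂ + 2 * δ := by rw [hδ]; ring
    rw [hβ] at h4
    nlinarith [h4, hlm, hδ0]
  obtain ⟨k, hk⟩ := exists_nat_gt
    ((Real.log C + (omega ℂ + δ) * Real.log N) / (δ * Real.log m))
  have hpos : 0 < δ * Real.log m := mul_pos hδ0 hlm
  have hk' : Real.log C + (omega ℂ + δ) * Real.log N < (k : ℝ) * (δ * Real.log m) := by
    rwa [div_lt_iff₀ hpos] at hk
  have := key k
  linarith

/-- **The crux = "ω is the GREATEST uniform step exponent of some tower"** (attainment at two
levels; compare `InfimumNotMinimumBarrier`: at ONE level ω is never attained, CW 1982). [folklore] -/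
theorem monotoneTower_iff_isGreatest :
    MonotoneTower ↔ ∃ N m : ℕ, 1 ≤ N ∧ 2 ≤ m ∧ IsGreatest {β : ℝ | TowerLaw β N m} (omega ℂ) := by
  constructor
  · rintro ⟨N, m, hN, hm, hl⟩
    exact ⟨N, m, hN, hm, hl, fun β hβ => towerLaw_exponent_le_omega hN hm hβ⟩
  · rintro ⟨N, m, hN, hm, hl, -⟩
    exact ⟨N, m, hN, hm, hl⟩

/-- Tower laws are monotone in the exponent (`m ≥ 1`). [folklore] -/
theorem towerLaw_mono {β β' : ℝ} {N m : ℕ} (hm : 1 ≤ m) (hβ : β' ≤ β) (h : TowerLaw β N m) :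
    TowerLaw β' N m := by
  intro k
  have hm1 : (1 : ℝ) ≤ m := by exact_mod_cast hm
  have hle : (m : ℝ) ^ β' ≤ (m : ℝ) ^ β := Real.rpow_le_rpow_of_exponent_le hm1 hβ
  have hg : (0 : ℝ) ≤ g(N * m ^ k) := Nat.cast_nonneg _
  exact (mul_le_mul_of_nonneg_right hle hg).trans (h k)

/-- **Knife edge, above:** a tower law with ANY exponent `β > 2` refutes the summit. [folklore] -/
theorem towerLaw_gt_two_refutes {β : ℝ} (hβ : 2 < β) {N m : ℕ} (hN : 1 ≤ N) (hm : 2 ≤ m)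
    (h : TowerLaw β N m) : ¬ _root_.MatrixMultiplication := by
  intro hS
  have hω : omega ℂ = 2 := hS
  have := towerLaw_exponent_le_omega hN hm h
  rw [hω] at this
  linarith

/-- In particular the crux with the RECORD constant `m^2.371339` in place of `m^ω` (a statement
implying the crux, by `towerLaw_mono` and the record) pins `ω = 2.371339` and kills `ω = 2`.
[cite: AlmanDuanVassilevskaWilliamsXuXuZhou2025, abstract] -/
theorem towerLaw_record_pins_omega (hrec : advxxz2025_omega_le) {N m : ℕ} (hN : 1 ≤ N) (hm : 2 ≤ m)
    (h : TowerLaw 2.371339 N m) : omega ℂ = 2.371339 ∧ ¬ _root_.MatrixMultiplication :=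
  ⟨le_antisymm hrec (towerLaw_exponent_le_omega hN hm h),
    towerLaw_gt_two_refutes (by norm_num) hN hm h⟩

/-- **Knife edge, below:** the crux implies its ω-free shadow `TowerLaw 2` ("`m² g(N m^k) ≤
g(N m^(k+1))` along some tower"), an exact-rank transfer law carrying no information on `ω`. [folklore] -/
theorem monotoneTower_imp_shadow (h : MonotoneTower) :
    ∃ N m : ℕ, 1 ≤ N ∧ 2 ≤ m ∧ TowerLaw 2 N m := by
  obtain ⟨N, m, hN, hm, hl⟩ := h
  exact ⟨N, m, hN, hm, towerLaw_mono (by omega) (omega_two_le ℂ) hl⟩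

/-- … and under the summit the crux IS its shadow: `ω = 2 → (TowerLaw 2 N m ↔ TowerLaw ω N m)`.
So `S → MonotoneTower` is exactly `S → shadow`, an open exact-rank lower-bound law (not in print,
not in tree): the crux is NOT a consequence of the summit by any visible means. [folklore] -/
theorem summit_imp_shadow_iff (hS : _root_.MatrixMultiplication) (N m : ℕ) :
    TowerLaw 2 N m ↔ TowerLaw (omega ℂ) N m := by
  have hω : omega ℂ = 2 := hS
  rw [hω]

/-- **The route's second binder is a consequence of the summit**: `ω = 2 → EfficientSteps`.
If some tower had all steps `> (1+ε) m²`, it would satisfy `TowerLaw (2 + log_m(1+ε))`, and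
`towerLaw_exponent_le_omega` would give `2 + log_m(1+ε) ≤ ω = 2`. [folklore] -/
theorem summit_imp_efficientSteps : _root_.MatrixMultiplication → EfficientSteps := by
  intro hS N m hN hm ε hε
  have hω : omega ℂ = 2 := hS
  by_contra hne
  push_neg at hne
  have hm1 : (1 : ℝ) < m := by exact_mod_cast hm
  have hm0 : (0 : ℝ) < m := by linarith
  have hε1 : (0 : ℝ) < 1 + ε := by linarith
  set β : ℝ := 2 + Real.logb m (1 + ε) with hβdef
  have hmβ : (m : ℝ) ^ β = (m : ℝ) ^ 2 * (1 + ε) := by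
    rw [hβdef, Real.rpow_add hm0, Real.rpow_logb hm0 hm1.ne' hε1, Real.rpow_two]
  have hlaw : TowerLaw β N m := by
    intro k
    rw [hmβ]
    have := hne k
    nlinarith [this]
  have hle := towerLaw_exponent_le_omega hN hm hlaw
  have hpos : 0 < Real.logb m (1 + ε) := Real.logb_pos hm1 (by linarith)
  rw [hω] at hle
  have : β = 2 + Real.logb m (1 + ε) := hβdef
  linarith

/-- **Smuggling, certified**: given the crux, the route's residual `EfficientSteps` is EQUIVALENT
to the summit — `closes` reduces `ω = 2` to `ω = 2`. [folklore] -/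
theorem residual_iff_summit (h : MonotoneTower) : EfficientSteps ↔ _root_.MatrixMultiplication :=
  ⟨closes h, summit_imp_efficientSteps⟩

/-- The natural two-piece split `MonotoneTower ⇐ shadow ∧ (shadow → MonotoneTower)` is not a
redirect: its upgrade piece is S-implied (and has no plan but S). [folklore] -/
theorem summit_imp_shadow_upgrade (hS : _root_.MatrixMultiplication) :
    (∃ N m : ℕ, 1 ≤ N ∧ 2 ≤ m ∧ TowerLaw 2 N m) → MonotoneTower := by
  rintro ⟨N, m, hN, hm, hl⟩
  exact ⟨N, m, hN, hm, (summit_imp_shadow_iff hS N m).1 hl⟩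

/-- **Price of an instance**: instance `k` of the crux on its tower is the exponent bound
`ω ≤ log_m (g(N m^(k+1)) / g(N m^k))` — an ω-UPPER bound certified by a ratio of two EXACT ranks. [folklore] -/
theorem towerLaw_prices {N m : ℕ} (hN : 1 ≤ N) (hm : 2 ≤ m) (h : TowerLaw (omega ℂ) N m) (k : ℕ) :
    omega ℂ ≤ Real.logb m (g(N * m ^ (k + 1)) / g(N * m ^ k)) := by
  have hm1 : (1 : ℝ) < m := by exact_mod_cast hm
  have hgk : (0 : ℝ) < g(N * m ^ k) := lt_of_lt_of_le one_pos (one_le_g hN (by omega) k)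
  have hgk1 : (0 : ℝ) < g(N * m ^ (k + 1)) := lt_of_lt_of_le one_pos (one_le_g hN (by omega) (k + 1))
  rw [Real.le_logb_iff_rpow_le hm1 (div_pos hgk1 hgk), le_div_iff₀ hgk]
  exact h k

/-- On the doubling tower `N = 1, m = 2` the first instance beyond Bläser's face (`k = 1`) reads
`7 · 2^ω ≤ R(⟨4,4,4⟩)`, using `R(⟨2,2,2⟩) = 7` (tree, Strassen / Winograd–Hopcroft–Kerr).
[cite: LandsbergGCT2017, §1.1.14 (p. 20)] -/
theorem doubling_step_one (h : TowerLaw (omega ℂ) 1 2) : 7 * (2 : ℝ) ^ omega ℂ ≤ g(4) := by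
  have h1 := h 1
  have h7 : ((tensorRank (matMulTensor ℂ 2 2 2) : ℕ) : ℝ) = 7 := by
    exact_mod_cast LandsbergGCT2017_tensorRank_matMulTensor_two_holds
  have e : ((2 : ℕ) : ℝ) = (2 : ℝ) := by norm_num
  change ((2 : ℕ) : ℝ) ^ omega ℂ * ((tensorRank (matMulTensor ℂ 2 2 2) : ℕ) : ℝ) ≤
    ((tensorRank (matMulTensor ℂ 4 4 4) : ℕ) : ℝ) at h1
  rw [h7, e] at h1
  linarith

/-- **… and its price**: were that instance certified with any outcome `R(⟨4,4,4⟩) ≤ 36`, it would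
give `ω < 2.37`, below the 2.371339 record (`2^237 > (36/7)^100`).  So proving even this one instance
needs a new exponent record or the rank lower bound `R(⟨4,4,4⟩) ≥ 37` (known: `29 ≤ R ≤ 48`). [folklore] -/
theorem doubling_step_one_price (h : 7 * (2 : ℝ) ^ omega ℂ ≤ g(4)) (h36 : g(4) ≤ 36) :
    omega ℂ < 2.37 := by
  by_contra hge
  push_neg at hge
  have h2 : (2 : ℝ) ^ (2.37 : ℝ) ≤ (2 : ℝ) ^ omega ℂ :=
    Real.rpow_le_rpow_of_exponent_le (by norm_num) hge
  have hup : (2 : ℝ) ^ omega ℂ ≤ 36 / 7 := by linarith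
  have h3 : (2 : ℝ) ^ (2.37 : ℝ) ≤ 36 / 7 := h2.trans hup
  have h4 : ((2 : ℝ) ^ (2.37 : ℝ)) ^ (100 : ℕ) = (2 : ℝ) ^ (237 : ℕ) := by
    rw [← Real.rpow_natCast ((2 : ℝ) ^ (2.37 : ℝ)) 100, ← Real.rpow_mul (by norm_num : (0 : ℝ) ≤ 2)]
    rw [show ((2.37 : ℝ) * ((100 : ℕ) : ℝ)) = ((237 : ℕ) : ℝ) by norm_num, Real.rpow_natCast]
  have h5 : ((2 : ℝ) ^ (2.37 : ℝ)) ^ (100 : ℕ) ≤ (36 / 7 : ℝ) ^ (100 : ℕ) :=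
    pow_le_pow_left₀ (by positivity) h3 100
  rw [h4] at h5
  norm_num at h5

/-- **Contrast — the shadow has rungs, the crux has none.**  At the very place where the crux's
instance `7·2^ω ≤ R(⟨4,4,4⟩)` is undecidable (`doubling_step_one_price`), the ω-free shadow's
instance `2² · R(⟨2,2,2⟩) = 28 ≤ R(⟨4,4,4⟩)` IS a theorem: Bläser 1999, `R(⟨n,n,n⟩) ≥ (5/2)n² − 3n`
(tree, `Blaser1999_rank_lower_bound_holds`).  The next shadow instance, `4·R(⟨4,4,4⟩) ≤ R(⟨8,8,8⟩)`,
is open again (`29 ≤ R(⟨4,4,4⟩) ≤ 48`, `136 ≤ R(⟨8,8,8⟩) ≤ 336`). [cite: Blaser1999, Thm 2] -/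
theorem shadow_doubling_step_one : ((2 : ℕ) : ℝ) ^ (2 : ℝ) * g(1 * 2 ^ 1) ≤ g(1 * 2 ^ (1 + 1)) := by
  have h7 : ((tensorRank (matMulTensor ℂ 2 2 2) : ℕ) : ℝ) = 7 := by
    exact_mod_cast LandsbergGCT2017_tensorRank_matMulTensor_two_holds
  have hB := Blaser1999_rank_lower_bound_holds ℂ 4
  change ((2 : ℕ) : ℝ) ^ (2 : ℝ) * ((tensorRank (matMulTensor ℂ 2 2 2) : ℕ) : ℝ) ≤
    ((tensorRank (matMulTensor ℂ 4 4 4) : ℕ) : ℝ)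
  have e : ((2 : ℕ) : ℝ) ^ (2 : ℝ) = 4 := by
    rw [show ((2 : ℕ) : ℝ) = (2 : ℝ) by norm_num, Real.rpow_two]; norm_num
  rw [h7, e]
  norm_num at hB
  have hB' : (28 : ℝ) ≤ ((tensorRank (matMulTensor ℂ 4 4 4) : ℕ) : ℝ) := by exact_mod_cast hB
  linarith

/-- Packaging for the census: the crux hands the route an ω-certificate machine with no input —
`MonotoneTower → ∃ tower, ∀ k, ω ≤ log_m(g_{k+1}/g_k)` — whose every instance is an exact-rank
comparison, and whose conjunction with the S-implied `EfficientSteps` is the summit. [folklore] -/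
theorem monotoneTower_anatomy :
    (MonotoneTower → ∃ N m : ℕ, 1 ≤ N ∧ 2 ≤ m ∧
        ∀ k : ℕ, omega ℂ ≤ Real.logb m (g(N * m ^ (k + 1)) / g(N * m ^ k))) ∧
    (MonotoneTower → (EfficientSteps ↔ _root_.MatrixMultiplication)) ∧
    (_root_.MatrixMultiplication → EfficientSteps) := by
  refine ⟨fun h => ?_, residual_iff_summit, summit_imp_efficientSteps⟩
  obtain ⟨N, m, hN, hm, hl⟩ := h
  exact ⟨N, m, hN, hm, towerLaw_prices hN hm hl⟩

end Summit.MatrixMultiplication.MatrixMultiplication.Cruxes.MonotoneTower.StrategistR1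

end
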